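import Summits.NavierStokesRegularity.NavierStokesRegularity.Theorems.ScenarioCensusRowA5HonestCell

/-!
# Screw Oseen gauge — part 5: regularity of the honest class (KNSS 2009 §4) and the SMOOTH cells A8cl / A5cl

`IsGenuine.smooth`: every genuine bounded continuous Oseen-mild field on `(−∞,T)` has `C^∞`, classically
divergence-free slices with ALL spatial derivatives bounded on `(−∞,T) × ℝ³` (one constant per order) — from the
tree's PROVED `FluidPDE.KNSS2009_mild_regularity_holds` (KNSS Prop. 4.1 / (4.8)–(4.11)) read on unit windows
(`IsGenuine.driftMild_unitWindow`).  Hence the smooth cells `RowA8HonestCell.Row_A8cl`, `RowA5HonestCell.Row_A5cl`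
and `row_A8gen_iff_row_A8cl`, `row_A8_iff_row_A8cl : Row_A8 ↔ Row_A8cl`, `row_A5gen_iff_row_A5cl`,
`axisymmetricLiouvilleBoundedSwirl_iff_row_A5cl`, with census aliases `ScenarioCensus.row_A8_iff_row_A8cl`,
`ScenarioCensus.axisymmetricLiouvilleBoundedSwirl_iff_row_A5cl`, `ScenarioCensus.row_A5_iff_row_A5cl` — the working
form for a PDE attack on rows A8 / A5 (vorticity, maximum principles, energy) is certified equivalent.

Re-homed for the census (typer seat; lead g6 ORDER 2026-08-28T14:22Z) from §7 of ns-idea-3's merged landable module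
`ScenarioCensusScrewGauge.lean` v2 (sha16 14413c7d80f9b0c0, 1292 lines, rc 0, 0 sorry, standard axioms); parts 1–4 are
`ScenarioCensusRowA8HonestGauge` / `…Boost` / `…Cell` / `ScenarioCensusRowA5HonestCell`.  Lean text verbatim
(A8 material in namespace `…RowA8HonestCell`, A5 material in `…RowA5HonestCell`).
No census value changes (A8, A8gen, A8cl, A5, A5gen, A5cl all OPEN — one statement per row); NS regularity is NOT
proved; no summit statement is proved by this file.
-/

noncomputable section

open MeasureTheory Set Filter Topology Function Metric
open scoped ENNReal NNReal

set_option linter.dupNamespace false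

namespace Summit.NavierStokesRegularity.NavierStokesRegularity.Theorems.ScenarioCensus.RowA8HonestCell

open Literature.Analysis Literature.Analysis.FluidPDE Literature.Analysis.UnboundedOperators
open Summit.NavierStokesRegularity.NavierStokesRegularity.Theorems.ScenarioCensus (Row_A8)

/-! ## §7  Regularity of the honest class (KNSS 2009 §4 — PROVED in the tree): the SMOOTH cells

Provers of `Row_A8gen` / `Row_A5gen` may take every slice `C^∞`, classically divergence-free, with ALL spatial
derivatives bounded on `(−∞,T) × ℝ³` by constants depending only on the order: a genuine field read on any unit
time window ending before `T` is a zero-drift bounded mild field in KNSS's sense (`IsGenuine.driftMild_unitWindow`),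
to which the tree's `KNSS2009_mild_regularity_holds` (Prop. 4.1 with (4.6), (4.8)–(4.11)) applies with constants
depending only on the velocity bound; every `τ < T` is the time `1 − ε`, `ε ≤ 1/4`, of such a window. Hence the
smooth cells `Row_A8cl` / `Row_A5cl` below are EQUIVALENT to `Row_A8gen` / `Row_A5gen`, so to row A8 / the A5 leaf. -/

/-- A genuine field read on a unit time window ending at `1 − L ≤ T` is a zero-drift KNSS bounded mild field on
`(0, 1)` with the field's own velocity bound. -/
theorem IsGenuine.driftMild_unitWindow {T : ℝ} {w : ℝ → E3 → E3} (hw : IsGenuine T w) {K : ℝ}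
    (hK : ∀ t < T, ∀ x, ‖w t x‖ ≤ K) {L : ℝ} (hL : 1 - L ≤ T) :
    IsKNSSDriftMild 1 K (fun t' y => w (t' - L) y) 0 := by
  obtain ⟨hm, -, -, hdiv, hmild⟩ := hw
  have hK0 : 0 ≤ K := (norm_nonneg _).trans (hK (T - 1) (by linarith) 0)
  have hE : Module.finrank ℝ E3 = 3 := finrank_euclideanSpace_fin
  refine ⟨measurable_zero, fun _ => by simpa using hK0, ?_, fun t' ht' x => ?_, ?_,
    fun s' t' hs' hst' ht'1 x => ?_⟩
  · have e : uncurry (fun t' y => w (t' - L) y) = uncurry w ∘ fun p : ℝ × E3 => (p.1 - L, p.2) := by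
      funext p; rfl
    rw [e]
    exact hm.comp ((measurable_fst.sub_const L).prodMk measurable_snd)
  · exact hK (t' - L) (by linarith [ht'.2]) x
  · exact (ae_restrict_iff' measurableSet_Ioo).2 (Eventually.of_forall fun t' ht' =>
      hdiv (t' - L) (by linarith [ht'.2]))
  · have hs'L : s' - L < t' - L := by linarith
    have ht'L : t' - L < T := by linarith
    have hvst := hmild (s' - L) (t' - L) hs'L ht'L x
    have hVm : ∀ σ ∈ Ioo s' t', Measurable (fun y => w (σ - L) y) := fun σ _ =>
      hm.comp (measurable_const.prodMk measurable_id)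
    have hVN : ∀ σ ∈ Ioo s' t', ∀ y, ‖w (σ - L) y‖ ≤ K := fun σ hσ y =>
      hK _ (by linarith [hσ.2]) y
    have hduh : driftDuhamel (fun t' y => w (t' - L) y) 0 s' t' x =
        oseenDuhamel 1 (s' - L) w w (t' - L) x := by
      rw [driftDuhamel_zero_eq_oseenDuhamel hE hVm hVN hst'.le x]
      have h := oseenDuhamel_time_translate 1 (s' - L) (t' - L) L w w x
      simp only [sub_add_cancel] at h
      exact h
    rw [hduh]
    show w (t' - L) x = heatExtension (w (s' - L)) (t' - s') x - oseenDuhamel 1 (s' - L) w w (t' - L) x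
    rw [hvst, show t' - L - (s' - L) = t' - s' by ring]

/-- **KNSS regularity of the honest class** (tree `KNSS2009_mild_regularity_holds`, KNSS 2009 Prop. 4.1 /
(4.8)–(4.11)): every genuine field on `(−∞,T)` has `C^∞`, classically divergence-free slices, and for every order
`k` ONE constant bounds `‖∇ᵏ w(τ,·)‖` for all `τ < T` (scale-invariant bounds of bounded ancient solutions). -/
theorem IsGenuine.smooth {T : ℝ} {w : ℝ → E3 → E3} (hw : IsGenuine T w) :
    (∀ τ < T, ContDiff ℝ (⊤ : ℕ∞) (w τ)) ∧ (∀ τ < T, VectorCalculus.IsDivFree (w τ)) ∧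
      ∀ k : ℕ, ∃ C : ℝ, ∀ τ < T, ∀ x, ‖iteratedFDeriv ℝ k (w τ) x‖ ≤ C := by
  obtain ⟨K, hK⟩ := hw.2.2.1
  obtain ⟨C, Lc, hCL⟩ := KNSS2009_mild_regularity_holds K 1 one_pos
  -- every `τ < T` is the time `1 − ε` (`0 < ε ≤ 1/4`) of a unit window ending at `τ + ε < T`
  have slice : ∀ τ < T, ∃ (V : ℝ → E3 → E3) (t : ℝ), t ∈ Ioo (1 / 2 : ℝ) 1 ∧
      IsKNSSDriftMild 1 K V 0 ∧ V t = w τ := by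
    intro τ hτ
    have hε0 : 0 < min (1 / 4 : ℝ) ((T - τ) / 2) := lt_min (by norm_num) (by linarith)
    have hε1 : min (1 / 4 : ℝ) ((T - τ) / 2) ≤ 1 / 4 := min_le_left _ _
    have hε2 : min (1 / 4 : ℝ) ((T - τ) / 2) ≤ (T - τ) / 2 := min_le_right _ _
    refine ⟨fun t' y => w (t' - (1 - τ - min (1 / 4 : ℝ) ((T - τ) / 2))) y,
      τ + (1 - τ - min (1 / 4 : ℝ) ((T - τ) / 2)), ⟨by linarith, by linarith⟩,
      hw.driftMild_unitWindow hK (by linarith), ?_⟩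
    funext y
    simp only [add_sub_cancel_right]
  refine ⟨fun τ hτ => ?_, fun τ hτ => ?_, fun k => ⟨C k (1 / 2), fun τ hτ x => ?_⟩⟩
  · obtain ⟨V, t, ht, hV, hVt⟩ := slice τ hτ
    have h := (hCL hV).1 t ⟨by linarith [ht.1], ht.2⟩
    rwa [hVt] at h
  · obtain ⟨V, t, ht, hV, hVt⟩ := slice τ hτ
    have h := (hCL hV).2.1 t ⟨by linarith [ht.1], ht.2⟩
    rwa [hVt] at h
  · obtain ⟨V, t, ht, hV, hVt⟩ := slice τ hτ
    have h := (hCL hV).2.2.1 (1 / 2) (by norm_num) k t ⟨ht.1, ht.2⟩ x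
    rwa [hVt] at h

/-- **Cell A8cl — the SMOOTH honest helical cell (≡ `Row_A8gen` ≡ row A8).** As `Row_A8gen`, for fields whose
slices are moreover `C^∞`, classically divergence-free, with all spatial derivatives bounded on `(−∞,T) × ℝ³`
(these are FREE: `IsGenuine.smooth`). The working form for a PDE attack (vorticity, maximum principles, energy). -/
def Row_A8cl : Prop :=
  ∀ h : ℝ, h ≠ 0 → ∀ (T : ℝ) (w : ℝ → E3 → E3), IsGenuine T w →
    (∀ τ < T, ContDiff ℝ (⊤ : ℕ∞) (w τ)) → (∀ τ < T, VectorCalculus.IsDivFree (w τ)) →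
      (∀ k : ℕ, ∃ C : ℝ, ∀ τ < T, ∀ x, ‖iteratedFDeriv ℝ k (w τ) x‖ ≤ C) →
        (∀ τ < T, ∀ (θ : ℝ) (y : E3), w τ (rotZ θ y + (h * θ) • e3) = rotZ θ (w τ y)) →
          ∀ τ < T, ∀ y, w τ y = w τ 0

/-- `Row_A8gen ↔ Row_A8cl` (the extra hypotheses are theorems of the honest class). -/
theorem row_A8gen_iff_row_A8cl : Row_A8gen ↔ Row_A8cl := by
  constructor
  · intro H h hh T w hw _ _ _ hsym
    exact H h hh T w hw hsym
  · intro H h hh T w hw hsym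
    obtain ⟨h1, h2, h3⟩ := hw.smooth
    exact H h hh T w hw h1 h2 h3 hsym

/-- **Row A8 IS its smooth honest cell.** -/
theorem row_A8_iff_row_A8cl : Row_A8 ↔ Row_A8cl :=
  row_A8_iff_row_A8gen.trans row_A8gen_iff_row_A8cl

end Summit.NavierStokesRegularity.NavierStokesRegularity.Theorems.ScenarioCensus.RowA8HonestCell

namespace Summit.NavierStokesRegularity.NavierStokesRegularity.Theorems.ScenarioCensus.RowA5HonestCell

open Literature.Analysis Literature.Analysis.FluidPDE Literature.Analysis.UnboundedOperators
open Summit.NavierStokesRegularity.NavierStokesRegularity (AxisymmetricLiouvilleBoundedSwirl)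
open Summit.NavierStokesRegularity.NavierStokesRegularity.Theorems.ScenarioCensus.RowA8HonestCell

/-- **Cell A5cl — the SMOOTH honest bounded-swirl cell (≡ `Row_A5gen` ≡ the A5 leaf).** -/
def Row_A5cl : Prop :=
  ∀ (T : ℝ) (w : ℝ → E3 → E3), IsGenuine T w →
    (∀ τ < T, ContDiff ℝ (⊤ : ℕ∞) (w τ)) → (∀ τ < T, VectorCalculus.IsDivFree (w τ)) →
      (∀ k : ℕ, ∃ C : ℝ, ∀ τ < T, ∀ x, ‖iteratedFDeriv ℝ k (w τ) x‖ ≤ C) →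
        (∀ τ < T, FluidPDE.IsAxisymmetric (w τ)) → (∃ C : ℝ, ∀ τ < T, ∀ y, |FluidPDE.swirl (w τ) y| ≤ C) →
          ∀ τ < T, ∀ y, w τ y = w τ 0

/-- `Row_A5gen ↔ Row_A5cl`. -/
theorem row_A5gen_iff_row_A5cl : Row_A5gen ↔ Row_A5cl := by
  constructor
  · intro H T w hw _ _ _ haxi hsw
    exact H T w hw haxi hsw
  · intro H T w hw haxi hsw
    obtain ⟨h1, h2, h3⟩ := hw.smooth
    exact H T w hw h1 h2 h3 haxi hsw

/-- **The A5 leaf IS its smooth honest cell.** -/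
theorem axisymmetricLiouvilleBoundedSwirl_iff_row_A5cl : AxisymmetricLiouvilleBoundedSwirl ↔ Row_A5cl :=
  axisymmetricLiouvilleBoundedSwirl_iff_row_A5gen.trans row_A5gen_iff_row_A5cl

end Summit.NavierStokesRegularity.NavierStokesRegularity.Theorems.ScenarioCensus.RowA5HonestCell

namespace Summit.NavierStokesRegularity.NavierStokesRegularity.Theorems.ScenarioCensus

/-- **Census alias: row A8 ≡ the SMOOTH cell A8cl** (slices `C^∞`, div-free, all derivatives bounded). -/
theorem row_A8_iff_row_A8cl : Row_A8 ↔ RowA8HonestCell.Row_A8cl := RowA8HonestCell.row_A8_iff_row_A8cl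

/-- **Census alias: the A5 leaf ≡ the SMOOTH cell A5cl.** -/
theorem axisymmetricLiouvilleBoundedSwirl_iff_row_A5cl :
    Summit.NavierStokesRegularity.NavierStokesRegularity.AxisymmetricLiouvilleBoundedSwirl ↔ RowA5HonestCell.Row_A5cl :=
  RowA5HonestCell.axisymmetricLiouvilleBoundedSwirl_iff_row_A5cl

/-- **Census alias: row A5 ≡ the SMOOTH cell A5cl** (`Row_A5` is the leaf `AxisymmetricLiouvilleBoundedSwirl` by name). -/
theorem row_A5_iff_row_A5cl : Row_A5 ↔ RowA5HonestCell.Row_A5cl :=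
  RowA5HonestCell.axisymmetricLiouvilleBoundedSwirl_iff_row_A5cl

end Summit.NavierStokesRegularity.NavierStokesRegularity.Theorems.ScenarioCensus
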